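/-
Copyright: the b2b-balaban cell (near-miss cell 7), T⁴-continuum fan-out; row NE7b ROUND-2 swarm, seat
t4-ne7b-formalise-leaf-03 (row S12 «ASSEMBLY» of `t4/b2b-balaban-t4-ne7b-p1/LEAVES-NE7b.md`; node A12 of the typer's
`t4/formal/NE7b/DAG.md`).  Released under the licence of the surrounding project.
-/
import Summits.QuantumFields.BalabanUV.T4Continuum.Support.HistoryAssemblyTerms
import Summits.QuantumFields.BalabanUV.T4Continuum.Support.HistoryGenTimed
import Summits.QuantumFields.BalabanUV.T4Continuum.Support.HistoryCaps

/-!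
# History assembly, THE INSTANCE: terms read as PEDIGREES of live components ⇒ the NE7b COUNT exit and seam

Summits-side support leaf of the T⁴-continuum cell (rung (B)+1 on a FINITE torus only; NOT infinite volume, NOT the
mass gap, NOT the Clay statement; NOT a proof of the spine estimate NE7b).  Row NE7b, route «COUNT», ROUND-2 swarm
row S12 (typer node A12: «the instance for `liveGen`»).  [folklore] COMPOSITION BY NAME of landed rows: S3
(`HistoryGen`∕`HistoryGenFresh`∕`HistoryGenTimed`, leaf-09 — the H1 data structure of record `Pedigree`, ruling
R-OWNER-22-4, and its tagged genealogy `genT` with `consistentT_genT`, `freshT_genT`, `chronoC_genT`), S5's caps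
(`HistoryCaps`, leaf-06), S12 §5 (`HistoryAssemblyTerms`).  Nothing is quoted from print, nothing printed is asserted,
no `[cite:]` tag, no `Prop`-valued fact of Bałaban's is minted (trigger c1): the identification H3 — «the terms of
Bałaban's density after `K` steps are indexed by pedigrees of pending components with their small-field data, the live
structures of a term being its pending components» — enters as the DISPLAYED reading map `ped`∕`liveC`∕`cellOf` and
the displayed `PedigreeReading`; (B) and the BetaPertH-flow facts stay the displayed binders of S12 §3 (c4).

WHAT.  §1 the member map `memOf ped liveC cellOf K τ` (the (root cell, tagged genealogy) pairs of the live components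
of the term's pedigree) and the hypothesis structure `PedigreeReading` — per cutoff `K ≥ K₀` and term `τ ∈ T K`: the
pedigree is TIMED for the run's table (`Pedigree.Timed`: every component observed by the cutoff, renewal of a component
of the previous step AT THE BOOKED REACH = the displayed `RenewAtReach` of ruling R-A, old parts pending at a join =
`JoinInLife`), a FOREST, OLDEST-LINE-FIRST; its live components are PENDING at the cutoff, rooted at cells of the
root's age (`HistoryTables.cellN`), with pairwise DISTINCT root cells.  §2 **`termReading_of_pedigree`**: these give
`HistoryAssemblyTerms.TermReading Prod.fst C (cellN d n L) (dcapOf …) (ncapOf …) jstar K₀ R T (memOf …)` — the caps READ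
OFF THE DATA (`HistoryCaps.dcapOf`∕`ncapOf`).  §3 **`hybridNE7_of_pedigreeReading_canon`**: the END — NE7b's COUNT exit
and seam along the tuned runs with everything kernel-able plugged, the live structures read as pedigrees.

THE CERTIFIED SUB-CLASS AND WHAT STAYS DISPLAYED (honest census).  DISPLAYED: the reading map (`ped`, `liveC`,
`cellOf`) with `PedigreeReading` (its `Timed` carries `RenewAtReach` — row S4c will remove it; `NoDropInLife` of ruling
R-OWNER-22-2 is implicit in reading the geometry at the cutoff's scales — row S6f; the zone-form twin additionally
displays `BirthShapeNodup` — rows S6e pt 2 ∕ S6g; the residual physical class is «equal-shape sibling crowds»: two or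
more regions of the same class born at the same step inside one pending structure, cornered to the zone entropy `1∕k!`
only, GAPS F-leaf05-2 ∕ F-ne7bp1g22-1(d)); the per-term PRICE READINGS `hprice`∕`hprice′` (row S10's TH comparison
makes them «printed per-operation factors × `Dominates`»); the four `Regeneration` numerator fields per run; the
constants (+ `κ₁ ≥ d·log L + 2 log 2`, `E₀ ≥ log (2 + birthMass C)`), the flow side (⇐ BetaPertH), tuning,
`irThresholdTH Prod.fst C F.L rr β₀ 0 ≤ log g⁻²`, the (2.5) side condition, the (B) side, NE7c's `ShellWeightBound`,
NE7's `ReindexedBudget`, four summable rates.  The geometric layer (rows S1b `HistoryRealise` ∕ S6 pt 3) DERIVES the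
six `PedigreeReading` fields from the realisation of the pedigree on the torus; this file does not wait for it.

HEADLINE (c4): «COUNT route: NE7b's exit + seam with every kernel-able binder plugged and the live structures read as
PEDIGREES; displayed = H3 reading map + timing∕forest∕pending∕root-cell facts + price readings + (B) + BetaPertH-flow +
NE7c socket + NE7 core budget» — NOT «NE7b proved».  HONEST DEPENDENCY (cell): continuum YM on T⁴ ⇐ BetaPertH ∧ nine
spine estimates (0/9 proved); BetaPertH ⇐ (D1) ∧ (D4) ∧ CAP+tail.  This file changes none of it.
-/

open Finset MeasureTheory
open Literature.MathematicalPhysics.QuantumFieldTheory.Balaban1983to89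
open T4PersistenceDictionary T4PersistentHistoryCount T4BankedInduction T4PrintedShapeBanking
open T4WeightBudget T4GlobalDenominator T4LiveClassFibration T4LiveStructureGas T4LiveGasToTerms T4RecordPriceSeam
open T4PartnerMultiplicity T4IndicatorShell T4MatchingAssembly T4MatchingClosure T4MatchingClosureSocket T4Continuum
open T4StabilitySocket T4BranchingRecordsGas T4TaggedShapeBanking T4CanonicalMenus T4RenewalChains
open Summit.QuantumFields.BalabanUV.T4Continuum.PlacementBatch
open Summit.QuantumFields.BalabanUV.T4Continuum.PlacementSkeleton
open Summit.QuantumFields.BalabanUV.T4Continuum.CountThresholdUniform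
open Summit.QuantumFields.BalabanUV.T4Continuum.CountThresholdExit
open Summit.QuantumFields.BalabanUV.T4Continuum.CountSeamJunction
open Summit.QuantumFields.BalabanUV.T4Continuum.LateMergers
open Summit.QuantumFields.BalabanUV.T4Continuum.HistoryFlow
open Summit.QuantumFields.BalabanUV.T4Continuum.HistoryRegeneration
open Summit.QuantumFields.BalabanUV.T4Continuum.HistoryTables
open Summit.QuantumFields.BalabanUV.T4Continuum.HistoryAssemblyTrees
open Summit.QuantumFields.BalabanUV.T4Continuum.HistorySocketTH
open Summit.QuantumFields.BalabanUV.T4Continuum.HistoryAssemblyTerms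
open Summit.QuantumFields.BalabanUV.T4Continuum.HistoryGen
open Summit.QuantumFields.BalabanUV.T4Continuum.HistoryCaps

namespace Summit.QuantumFields.BalabanUV.T4Continuum.HistoryAssemblyPedigree

noncomputable section

/-! ## §1 Terms read as pedigrees: the member map and the reading -/

section Reading

variable {ι α π γ : Type*} [DecidableEq α] [DecidableEq π] [DecidableEq γ]

/-- decidable equality of tagged genealogies over pedigree labels — named, so that instance search finds it under
products and `Finset` (the member sets below are finite sets of (cell, tagged genealogy) pairs). [folklore] -/
instance instDecidableEqGenLab : DecidableEq (Gen (Lab α π)) := inferInstance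

/-- **THE LIVE MEMBERS OF A TERM READ AS A PEDIGREE**: the (root cell, tagged genealogy) pairs of the live components of
the term's pedigree at cutoff `K`. [folklore] -/
def memOf (ped : ℕ → ι → Pedigree α π) (liveC : ℕ → ι → Finset α) (cellOf : ℕ → ι → α → γ) (K : ℕ) (τ : ι) :
    Finset (γ × Gen (Lab α π)) :=
  (liveC K τ).image fun c => (cellOf K τ c, (ped K τ).genT c)

/-- membership in the member set [folklore] -/
theorem mem_memOf {ped : ℕ → ι → Pedigree α π} {liveC : ℕ → ι → Finset α} {cellOf : ℕ → ι → α → γ} {K : ℕ} {τ : ι}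
    {q : γ × Gen (Lab α π)} :
    q ∈ memOf ped liveC cellOf K τ ↔ ∃ c ∈ liveC K τ, (cellOf K τ c, (ped K τ).genT c) = q := mem_image

/-- **THE PEDIGREE READING** (a hypothesis SHAPE — the per-term facts the geometric layer derives; rows S1b ∕ S6 pt 3):
for every cutoff `K ≥ K₀` and term `τ ∈ T K`, the term's pedigree is TIMED for the run's window table (observed by the
cutoff; renewals of previous-step components AT THE BOOKED REACH — `RenewAtReach`; old parts of a join pending at the
join step — `JoinInLife`), a FOREST (distinct parts have disjoint ancestries), OLDEST LINE FIRST; its live components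
are PENDING at the cutoff, their root cells are cells of the root's age, and distinct live components have distinct
root cells. [folklore] -/
structure PedigreeReading (C : T4PrintedShapeBanking.Consts) (Cell : ℕ → ℕ → Finset γ) (K₀ : ℕ) (R : ℕ → ℕ → ℕ)
    (T : ℕ → Finset ι) (ped : ℕ → ι → Pedigree α π) (liveC : ℕ → ι → Finset α) (cellOf : ℕ → ι → α → γ) :
    Prop where
  /-- the pedigree is timed for the run's table (cutoff, `RenewAtReach`, `JoinInLife`) -/
  timed : ∀ K, K₀ ≤ K → ∀ τ ∈ T K, (ped K τ).Timed K (dictWT Prod.fst (R K) C.n₁)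
  /-- the pedigree is a forest -/
  forest : ∀ K, K₀ ≤ K → ∀ τ ∈ T K, ∀ c, (ped K τ).Forest c
  /-- oldest line first at every component -/
  headOldest : ∀ K, K₀ ≤ K → ∀ τ ∈ T K, ∀ c, (ped K τ).HeadOldest c
  /-- live components are pending at the cutoff -/
  pending : ∀ K, K₀ ≤ K → ∀ τ ∈ T K, ∀ c ∈ liveC K τ, K < ((ped K τ).genT c).reach (dictWT Prod.fst (R K) C.n₁)
  /-- the root cell of a live component is a cell of the root's age -/
  cell_mem : ∀ K, K₀ ≤ K → ∀ τ ∈ T K, ∀ c ∈ liveC K τ, cellOf K τ c ∈ Cell K (K - ((ped K τ).genT c).rootStep)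
  /-- distinct live components of one term have distinct root cells -/
  cell_inj : ∀ K, K₀ ≤ K → ∀ τ ∈ T K, Set.InjOn (cellOf K τ) (liveC K τ : Set α)

end Reading

/-! ## §2 The pedigree reading gives the term reading (caps read off the data) -/

section ToTerms

variable {ι α π γ : Type*} [DecidableEq α] [DecidableEq π] [DecidableEq γ]
  {C : T4PrintedShapeBanking.Consts} {Cell : ℕ → ℕ → Finset γ} {K₀ : ℕ} {R : ℕ → ℕ → ℕ} {T : ℕ → Finset ι}
  {ped : ℕ → ι → Pedigree α π} {liveC : ℕ → ι → Finset α} {cellOf : ℕ → ι → α → γ}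

/-- **THE PEDIGREE READING GIVES THE TERM READING** for the member map `memOf`, with the class cap `dcapOf` and the
fuel cap `ncapOf` READ OFF THE DATA, for any matching scale: `consistent` by `Pedigree.consistentT_genT`, `fresh` by
`freshT_genT`, `chrono` by `chronoC_genT` (row S3), `fat_lt`∕`fuel_le` by `HistoryCaps` (row S5), `pending`∕`cell_mem`
from the reading, `inj` from distinct root cells. [folklore] -/
theorem termReading_of_pedigree (H : PedigreeReading C Cell K₀ R T ped liveC cellOf) (jstar : ℕ → ℕ) :
    TermReading Prod.fst C Cell (dcapOf Prod.fst T (memOf ped liveC cellOf)) (ncapOf T (memOf ped liveC cellOf))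
      jstar K₀ R T (memOf ped liveC cellOf) where
  consistent K hK τ hτ q hq := by
    obtain ⟨c, -, rfl⟩ := mem_memOf.1 hq
    exact Pedigree.consistentT_genT (H.timed K hK τ (mem_badTerms.1 hτ).1) c
  fresh K hK τ hτ q hq := by
    obtain ⟨c, -, rfl⟩ := mem_memOf.1 hq
    exact Pedigree.freshT_genT (H.forest K hK τ (mem_badTerms.1 hτ).1) c
  pending K hK τ hτ q hq := by
    obtain ⟨c, hc, rfl⟩ := mem_memOf.1 hq
    exact H.pending K hK τ (mem_badTerms.1 hτ).1 c hc
  cell_mem K hK τ hτ q hq := by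
    obtain ⟨c, hc, rfl⟩ := mem_memOf.1 hq
    exact H.cell_mem K hK τ (mem_badTerms.1 hτ).1 c hc
  chrono K hK τ hτ q hq := by
    obtain ⟨c, -, rfl⟩ := mem_memOf.1 hq
    exact Pedigree.chronoC_genT (H.headOldest K hK τ (mem_badTerms.1 hτ).1) c
  fat_lt K hK τ hτ q hq e he hk :=
    fat_lt_of_mem Prod.fst T (memOf ped liveC cellOf) K₀ K hK τ (mem_badTerms.1 hτ).1 q hq e he hk
  fuel_le K hK τ hτ q hq := fuel_le_of_mem T (memOf ped liveC cellOf) K₀ K hK τ (mem_badTerms.1 hτ).1 q hq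
  inj K hK τ hτ := by
    intro q hq q' hq' hs
    obtain ⟨c, hc, rfl⟩ := mem_memOf.1 (Finset.mem_coe.1 hq)
    obtain ⟨c', hc', rfl⟩ := mem_memOf.1 (Finset.mem_coe.1 hq')
    have hcell : cellOf K τ c = cellOf K τ c' := by
      have := congrArg (fun s : BSlot γ PEv => s.2.1) hs
      simpa [bslotOf] using this
    have hcc : c = c' := H.cell_inj K hK τ (mem_badTerms.1 hτ).1 (Finset.mem_coe.2 hc) (Finset.mem_coe.2 hc') hcell
    subst hcc
    rfl

end ToTerms

/-! ## §3 The END: NE7b's COUNT exit and seam with the live structures read as pedigrees -/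

section End

variable {F : T4Family} {G : Type*} [GaugeGroup G] [MeasurableSpace G] [HaarData G] [RegularGaugeGroup G]
variable {α π : Type*} [DecidableEq α] [DecidableEq π]
variable {ι : Type*} [DecidableEq ι] {l₀ vol : ℝ} {K₀ : ℕ} {T : ℕ → Finset ι} {A A' shA shB : ℕ → ℝ → ι → ℝ}
  {dead dead' : ℕ → ℝ → ι → ℝ} {nup mup : ℕ → ℝ → ℝ} {Nup : ℝ}
  {Cc Rr CcRec RrRec : ℕ → ℝ → ι → ℝ} {ν u s₂ q₀ r s Wsh : ℕ → ℝ}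

/-- **NE7b's COUNT EXIT WITH THE LIVE STRUCTURES READ AS PEDIGREES.**
`HistoryAssemblyTerms.hybridNE7_of_termReading_canon` (the tree-slot exit at `D = 0`, `Δ = 1` along the tuned runs with
typed flow, cells `cellN d n F.L`, matching scale `jhalf`, rates and both `Regeneration` runs plugged; classes = bslot
families of terms, `bad_subset` proved, the four tree-slot binders built) with the term reading SUPPLIED by
`termReading_of_pedigree` from the displayed `PedigreeReading` of the reading map `ped`∕`liveC`∕`cellOf`, caps read off
the data.  Displayed: the reading map + `PedigreeReading`; the per-term price readings; the `Regeneration` numerator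
fields per run over the classes `bstrOf Prod.fst (memOf …)` ∕ `badClasses …`; constants + two largeness conditions;
flow side; tuning; `irThresholdTH Prod.fst C F.L rr β₀ 0 ≤ log g⁻²`; the (2.5) side condition; the (B) side; the seam
data. [folklore] -/
theorem hybridNE7_of_pedigreeReading_canon (D : FiniteEpsData F G) {C : T4PrintedShapeBanking.Consts}
    {rr : ℕ} {β₀ : ℝ} (h : ThresholdOK C F.L rr β₀) (hμ : 0 < C.μ) (d n : ℕ)
    (hκ₁ : (d : ℝ) * Real.log F.L + 2 * Real.log 2 ≤ C.κ₁) (hE₀ : Real.log (2 + birthMass C) ≤ C.E₀)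
    -- the flow side (⇐ BetaPertH, displayed) and tuning
    {γ₀ γb b β' : ℝ} {pe : ℕ} (hb : 0 ≤ b) (hlo : FlowStep.BetaLowerH b γ₀ D.βfun)
    (hhi : FlowStep.BetaUpperH β' γ₀ D.βfun) (hγ : γb ≤ γ₀) (hγβ : γb ^ 2 * β' < 1)
    (S : B14FlowStep.SmallnessFor γb β' β₀ F.L pe) (hp₀ : C.p₀ ≤ pe) (hrr : rr ≤ pe)
    {g : ℝ} {g₀ : ℕ → ℝ} (ht : D.Tuned γb g g₀)
    (hir : irThresholdTH (Prod.fst : Lab α π → PEv) C F.L rr β₀ 0 ≤ Real.log (g ^ 2)⁻¹)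
    -- the (B) side
    (hsign : B16.SignConventions D.C) {γB : ℝ} {em ep : ℝ → ℝ} (hcor : B16.Cor3With D.C γB em ep) (hγB : γb ≤ γB)
    {obs : (K : ℕ) → GaugeField (F.P K) 0 G → ℝ} {B : ℝ}
    (hobs : ∀ K, Measurable (obs K)) (hbd : ∀ K U, |obs K U| ≤ B)
    (hα : ∀ K t, |t| ≤ l₀ → K₀ ≤ K →
      ∫ U, Real.exp (t * obs K U) * D.dens K (g₀ K) 0 U ∂fieldMeasure (F.P K) 0 G ≤ ∑ τ ∈ T K, A K t τ)
    (hα' : ∀ K t, |t| ≤ l₀ → K₀ ≤ K →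
      ∫ U, Real.exp (t * obs (K + 1) U) * D.dens (K + 1) (g₀ (K + 1)) 0 U ∂fieldMeasure (F.P (K + 1)) 0 G ≤
        ∑ τ ∈ T K, A' K t τ)
    {c₀ n₁ : ℝ} (hc₀ : 0 < c₀) (hfloor : ∀ K, K₀ ≤ K → c₀ ≤ smallFieldMass D K (g₀ K))
    (hfloor' : ∀ K, K₀ ≤ K → c₀ ≤ smallFieldMass D (K + 1) (g₀ (K + 1)))
    (hsites : ∀ K, K₀ ≤ K → ((D.C ⟨K, F.m, g₀ K⟩).numSites K : ℝ) ≤ n₁)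
    (hsites' : ∀ K, K₀ ≤ K → ((D.C ⟨K + 1, F.m, g₀ (K + 1)⟩).numSites (K + 1) : ℝ) ≤ n₁)
    (hNup : 0 ≤ Nup) (hnup : ∀ K t, |t| ≤ l₀ → K₀ ≤ K → 0 ≤ nup K t ∧ nup K t ≤ Nup)
    (hmup : ∀ K t, |t| ≤ l₀ → K₀ ≤ K → 0 ≤ mup K t ∧ mup K t ≤ Nup)
    -- the (2.5) side condition on the size function
    (R : ℕ → ℕ → ℕ) (hR : ∀ K s, s ≤ K → B14.IsRj F.L rr ((D.C ⟨K, F.m, g₀ K⟩).flow.g s) (R K s))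
    -- H3: the terms read as PEDIGREES of live components with root cells, and their reading
    (ped : ℕ → ι → Pedigree α π) (liveC : ℕ → ι → Finset α) (cellOf : ℕ → ι → α → (Fin d → ℕ))
    (H : PedigreeReading C (cellN d n F.L) K₀ R T ped liveC cellOf)
    {Fc Rf Fc' Rf' : ℕ → Finset (BSlot (Fin d → ℕ) PEv) → ℝ}
    (hprice : ∀ K t, |t| ≤ l₀ → K₀ ≤ K → ∀ τ ∈ badTerms (memOf ped liveC cellOf) jhalf T K,
      Fc K (bstrOf Prod.fst (memOf ped liveC cellOf) K τ) * Rf K (bstrOf Prod.fst (memOf ped liveC cellOf) K τ) ≤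
        ∏ q ∈ memOf ped liveC cellOf K τ,
          priceT Prod.fst C ((F.L : ℝ) ^ d) R (fun K => (D.C ⟨K, F.m, g₀ K⟩).flow.g) K q)
    (hprice' : ∀ K t, |t| ≤ l₀ → K₀ ≤ K → ∀ τ ∈ badTerms (memOf ped liveC cellOf) jhalf T K,
      Fc' K (bstrOf Prod.fst (memOf ped liveC cellOf) K τ) * Rf' K (bstrOf Prod.fst (memOf ped liveC cellOf) K τ) ≤
        ∏ q ∈ memOf ped liveC cellOf K τ,
          priceT Prod.fst C ((F.L : ℝ) ^ d) R (fun K => (D.C ⟨K, F.m, g₀ K⟩).flow.g) K q)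
    -- H3: the remaining `Regeneration` numerator readings, over the classes of the terms
    (up : ∀ K t, |t| ≤ l₀ → K₀ ≤ K → ∀ c ∈ badClasses Prod.fst (memOf ped liveC cellOf) jhalf T K,
      ∀ τ ∈ fibre (bstrOf Prod.fst (memOf ped liveC cellOf)) T K c, A K t τ ≤ dead K t τ * Fc K c * nup K t)
    (dead_nonneg : ∀ K t, |t| ≤ l₀ → K₀ ≤ K → ∀ c ∈ badClasses Prod.fst (memOf ped liveC cellOf) jhalf T K,
      ∀ τ ∈ fibre (bstrOf Prod.fst (memOf ped liveC cellOf)) T K c, 0 ≤ dead K t τ)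
    (resum : ∀ K t, |t| ≤ l₀ → K₀ ≤ K → ∀ c ∈ badClasses Prod.fst (memOf ped liveC cellOf) jhalf T K,
      ∑ τ ∈ fibre (bstrOf Prod.fst (memOf ped liveC cellOf)) T K c, dead K t τ ≤ Rf K c)
    (F_nonneg : ∀ K t, |t| ≤ l₀ → K₀ ≤ K → ∀ c ∈ badClasses Prod.fst (memOf ped liveC cellOf) jhalf T K, 0 ≤ Fc K c)
    (up' : ∀ K t, |t| ≤ l₀ → K₀ ≤ K → ∀ c ∈ badClasses Prod.fst (memOf ped liveC cellOf) jhalf T K,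
      ∀ τ ∈ fibre (bstrOf Prod.fst (memOf ped liveC cellOf)) T K c, A' K t τ ≤ dead' K t τ * Fc' K c * mup K t)
    (dead'_nonneg : ∀ K t, |t| ≤ l₀ → K₀ ≤ K → ∀ c ∈ badClasses Prod.fst (memOf ped liveC cellOf) jhalf T K,
      ∀ τ ∈ fibre (bstrOf Prod.fst (memOf ped liveC cellOf)) T K c, 0 ≤ dead' K t τ)
    (resum' : ∀ K t, |t| ≤ l₀ → K₀ ≤ K → ∀ c ∈ badClasses Prod.fst (memOf ped liveC cellOf) jhalf T K,
      ∑ τ ∈ fibre (bstrOf Prod.fst (memOf ped liveC cellOf)) T K c, dead' K t τ ≤ Rf' K c)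
    (F'_nonneg : ∀ K t, |t| ≤ l₀ → K₀ ≤ K → ∀ c ∈ badClasses Prod.fst (memOf ped liveC cellOf) jhalf T K,
      0 ≤ Fc' K c)
    -- the seam's other inputs
    (hSh : ShellWeightBound l₀ T A A' shA shB Wsh)
    (hTB : ReindexedBudget l₀ vol T (fun K t τ => A K t τ - shA K t τ) (fun K t τ => A' K t τ - shB K t τ)
      (badOfClass (bstrOf Prod.fst (memOf ped liveC cellOf)) T
        (fun K _ => badClasses Prod.fst (memOf ped liveC cellOf) jhalf T K)) Cc Rr CcRec RrRec ν u s₂ q₀ r s)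
    (hr : Summable r) (hu : Summable u) (hs : Summable s) (hs₂ : Summable s₂) :
    ∃ K₁ K₂, K₀ ≤ K₁ ∧ HybridNE7 l₀ vol (fun K => T (K₁ + (K₂ + K))) (fun K => A (K₁ + (K₂ + K)))
      (fun K => A' (K₁ + (K₂ + K)))
      (fun K => badOfClass (bstrOf Prod.fst (memOf ped liveC cellOf)) T
        (fun K _ => badClasses Prod.fst (memOf ped liveC cellOf) jhalf T K) (K₁ + (K₂ + K)))
      (fun K => constOf l₀ B (max (em g) 0) n₁ c₀ Nup *
        recordsBudget (birthMass C) C.κ₁ ((n : ℝ) ^ d) ((F.L : ℝ) ^ d) (Real.log 2) jhalf (K₁ + (K₂ + K)))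
      (fun K => shA (K₁ + (K₂ + K))) (fun K => shB (K₁ + (K₂ + K))) (fun K => Wsh (K₁ + (K₂ + K)))
      (fun K => (r (K₁ + (K₂ + K)) + u (K₁ + (K₂ + K))) + (s (K₁ + (K₂ + K)) + s₂ (K₁ + (K₂ + K)))) :=
  hybridNE7_of_termReading_canon D Prod.fst h hμ d n (dcapOf Prod.fst T (memOf ped liveC cellOf))
    (ncapOf T (memOf ped liveC cellOf)) hκ₁ hE₀ hb hlo hhi hγ hγβ S hp₀ hrr ht hir hsign hcor hγB hobs hbd hα hα' hc₀
    hfloor hfloor' hsites hsites' hNup hnup hmup R hR (memOf ped liveC cellOf) (termReading_of_pedigree H jhalf) hprice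
    hprice' up dead_nonneg resum F_nonneg up' dead'_nonneg resum' F'_nonneg hSh hTB hr hu hs hs₂

end End

end

end Summit.QuantumFields.BalabanUV.T4Continuum.HistoryAssemblyPedigree
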